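import Literature.Barriers.Parity.EquidistributionLimits
import Literature.NumberTheory.Sieve.BrunPureSieve
import HarnessLib

/-!
# The Maier matrix for two arithmetic progressions (Granville–Soundararajan, Proposition 2.2),
# specialised to subsets of the primes

Support file for `Literature/Barriers/Parity/EquidistributionLimitsProofs.lean` (discharge of
`Literature.Barriers.Parity.EquidistributionLimitBarrier`). We formalise Granville–Soundararajan's
Proposition 2.2 [cite: GranvilleSoundararajan2007Uncertainty, §2 Proposition 2.2] in the special case of a subset `𝒜` of
the primes (their Example 2: `f_q(a) = 1_{(a,q)=1}`, `γ_q = φ(q)/q`, and `ℓ` prime): the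
"Maier matrix" with `(i, j)`-th entry `i q + j ℓ` (`I₀ < i ≤ I₀ + H`, `1 ≤ j ≤ J`,
`I₀ = ⌈x/4q⌉`, `H = ⌊x/4q⌋`, `J = ⌊x/4ℓ⌋`, all entries in `(x/4, x)`) is counted along its rows —
segments of the progressions `i q (mod ℓ)` — and along its columns — segments of the progressions
`j ℓ (mod q)`. If `𝒜` were regular at scale `x` to BOTH moduli in the sense negating the barrier,

  `|𝒜(y; m, a) - (1/φ(m)) (y 𝒜(x)/x)| < c 𝒜(x)/φ(m)` for all `y ∈ (x/4, x)`, `(a, m) = 1`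
  (notation `APRegular[𝒜, x, c, m]`, the quantity `Δ_m` of (2.4) of the source being `< c`),

then comparing the two counts gives `|Φ_q(J) · q/φ(q) - J| ≤ 30 c J`, where
`Φ_q(J) = #{j ≤ J : (j, q) = 1}` (`maierMatrix_bounds`): the proportion of reduced residues among
`j ≤ J` would have to be within `30c` of `φ(q)/q`. (Rows with `ℓ ∣ i` and columns with
`(j, q) > 1` contain no primes, hence no element of `𝒜`.) The companion file
`EquidistributionLimitsSieve.lean` shows that this proportion deviates from `φ(q)/q` by a fixed
amount for suitable `q`, which is the contradiction proving the barrier.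

## Contents (all proved)

* `APRegular[𝒜, x, c, m]` (local notation: the regularity hypothesis `Δ_m < c` at scale `x`);
* counting lemmas: `subsetCountMod_natCast`, `subsetCountMod_sub_eq_card` (segments),
  `card_filter_ap_eq` (a segment of `k ↦ b + k m` is a segment of the class `b (mod m)`),
  `not_mem_of_dvd_row`, `not_mem_of_not_coprime_col`;
* the two real-variable inequalities `maierMatrix_algebra_upper/lower` closing the comparison;
* `maierMatrix_bounds` (Proposition 2.2 for subsets of the primes, in the form used downstream).

## References

* A. Granville, K. Soundararajan, *An uncertainty principle for arithmetic sequences*, Ann. of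
  Math. 165 (2007), 593–635; §2, (2.4) and Proposition 2.2 with its proof (the `R × S` Maier
  matrix `(R+r)q + sℓ`). [GranvilleSoundararajan2007Uncertainty]
* H. Maier, *Primes in short intervals*, Michigan Math. J. 32 (1985), 221–225 (the matrix method). [Maier1985]
-/

noncomputable section

open Finset

namespace Literature.Barriers.Parity

/-! ### The regularity hypothesis -/

/-- **Regularity of `𝒜` to the modulus `m` at scale `x` with constant `c`** (the negation, for one
modulus, of the conclusion of `EquidistributionLimitBarrier`; in the source's notation (2.4),
`Δ_m(x) < c` for the sequence `𝒜` with `f_m(a)/(m γ_m) = 1/φ(m)` on `(a, m) = 1`):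
for all `y ∈ (x/4, x)` and all `a` coprime to `m`,
`|𝒜(y; m, a) - (1/φ(m)) · y 𝒜(x)/x| < c · 𝒜(x)/φ(m)` (Granville–Soundararajan (2.4), Example 2).
A local notation (no definition is introduced), so that the hypotheses below are literally the
instances of the negated barrier. -/
local notation3 "APRegular[" 𝒜 ", " x ", " c ", " m "]" =>
  ∀ y : ℝ, x / 4 < y → y < x → ∀ a : ℕ, Nat.Coprime a m →
    |((subsetCountMod 𝒜 m a y : ℕ) : ℝ) - 1 / ((Nat.totient m : ℕ) : ℝ) *
        (y * ((subsetCount 𝒜 x : ℕ) : ℝ) / x)| <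
      c * (((subsetCount 𝒜 x : ℕ) : ℝ) / ((Nat.totient m : ℕ) : ℝ))

/-! ### Counting lemmas -/

section Counting

variable (𝒜 : Set ℕ) [DecidablePred (· ∈ 𝒜)]

/-- At an integer point the counting function `𝒜(n; m, a)` is a `Finset` cardinality. [folklore] -/
theorem subsetCountMod_natCast (m a n : ℕ) :
    subsetCountMod 𝒜 m a n = #{k ∈ range (n + 1) | k ∈ 𝒜 ∧ k ≡ a [MOD m]} := by
  unfold subsetCountMod
  rw [← Set.ncard_coe_finset]
  congr 1
  ext k
  simp only [Set.mem_setOf_eq, coe_filter, mem_range, Nat.cast_le]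
  constructor
  · rintro ⟨h1, h2, h3⟩
    exact ⟨Nat.lt_succ_of_le h2, h1, h3⟩
  · rintro ⟨h1, h2, h3⟩
    exact ⟨h2, Nat.lt_succ_iff.mp h1, h3⟩

/-- Counting a segment: `𝒜(n₂; m, a) - 𝒜(n₁; m, a) = #{n₁ < k ≤ n₂ : k ∈ 𝒜, k ≡ a (mod m)}`.
[folklore] -/
theorem subsetCountMod_sub_eq_card (m a : ℕ) {n₁ n₂ : ℕ} (h : n₁ ≤ n₂) :
    (subsetCountMod 𝒜 m a n₂ : ℝ) - subsetCountMod 𝒜 m a n₁ =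
      #{k ∈ Ioc n₁ n₂ | k ∈ 𝒜 ∧ k ≡ a [MOD m]} := by
  rw [subsetCountMod_natCast, subsetCountMod_natCast]
  have hunion : range (n₂ + 1) = range (n₁ + 1) ∪ Ioc n₁ n₂ := by
    ext k
    simp only [mem_union, mem_range, mem_Ioc]
    omega
  have hdisj : Disjoint ((range (n₁ + 1)).filter (fun k => k ∈ 𝒜 ∧ k ≡ a [MOD m]))
      ((Ioc n₁ n₂).filter (fun k => k ∈ 𝒜 ∧ k ≡ a [MOD m])) := by
    rw [disjoint_left]
    intro k hk hk'
    have h1 := mem_range.mp (mem_filter.mp hk).1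
    have h2 := (mem_Ioc.mp (mem_filter.mp hk').1).1
    omega
  rw [hunion, filter_union, card_union_of_disjoint hdisj, Nat.cast_add]
  ring

omit [DecidablePred (· ∈ 𝒜)] in
/-- A segment of consecutive terms `b + k m` (`k₀ < k ≤ k₁`) of an arithmetic progression is the
set of members of the class `b (mod m)` in the interval `(b + k₀ m, b + k₁ m]`; counted inside `𝒜`.
[folklore] -/
theorem card_filter_ap_eq [DecidablePred (· ∈ 𝒜)] (b m k₀ k₁ : ℕ) (hm : 0 < m) :
    #{k ∈ Ioc k₀ k₁ | b + k * m ∈ 𝒜} =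
      #{n ∈ Ioc (b + k₀ * m) (b + k₁ * m) | n ∈ 𝒜 ∧ n ≡ b [MOD m]} := by
  refine card_nbij' (fun k => b + k * m) (fun n => (n - b) / m) ?_ ?_ ?_ ?_
  · intro k hk
    simp only [coe_filter, mem_Ioc, Set.mem_setOf_eq] at hk ⊢
    obtain ⟨⟨hk0, hk1⟩, hkA⟩ := hk
    refine ⟨⟨?_, ?_⟩, hkA, ?_⟩
    · have := Nat.mul_lt_mul_of_pos_right hk0 hm
      omega
    · have := Nat.mul_le_mul_right m hk1
      omega
    · unfold Nat.ModEq
      rw [Nat.add_mul_mod_self_right]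
  · intro n hn
    simp only [coe_filter, mem_Ioc, Set.mem_setOf_eq] at hn ⊢
    obtain ⟨⟨hn0, hn1⟩, hnA, hmod⟩ := hn
    have hbn : b ≤ n := by
      have : b ≤ b + k₀ * m := Nat.le_add_right b _
      omega
    have hdvd : m ∣ n - b := (Nat.modEq_iff_dvd' hbn).mp hmod.symm
    obtain ⟨k, hk⟩ := hdvd
    have hn_eq : n = b + m * k := by omega
    have hdiv : (n - b) / m = k := by rw [hk, Nat.mul_div_cancel_left k hm]
    rw [hdiv]
    refine ⟨⟨?_, ?_⟩, ?_⟩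
    · by_contra hcon
      have hcon : k ≤ k₀ := not_lt.mp hcon
      have : m * k ≤ k₀ * m := by rw [mul_comm]; exact Nat.mul_le_mul_right m hcon
      omega
    · by_contra hcon
      have hcon : k₁ < k := not_le.mp hcon
      have : k₁ * m < k * m := Nat.mul_lt_mul_of_pos_right hcon hm
      rw [mul_comm k m] at this
      omega
    · rw [mul_comm k m, ← hn_eq]
      exact hnA
  · intro k _
    show (b + k * m - b) / m = k
    rw [Nat.add_sub_cancel_left, Nat.mul_div_cancel k hm]
  · intro n hn
    simp only [coe_filter, mem_Ioc, Set.mem_setOf_eq] at hn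
    obtain ⟨⟨hn0, -⟩, -, hmod⟩ := hn
    have hbn : b ≤ n := by
      have : b ≤ b + k₀ * m := Nat.le_add_right b _
      omega
    have hdvd : m ∣ n - b := (Nat.modEq_iff_dvd' hbn).mp hmod.symm
    show b + (n - b) / m * m = n
    rw [Nat.div_mul_cancel hdvd]
    omega

end Counting

/-- In the row of index `i` with `ℓ ∣ i`, every entry `i q + j ℓ` is a proper multiple of the
prime `ℓ`, hence not in a set of primes. [cite: GranvilleSoundararajan2007Uncertainty, §2 proof of Proposition 2.2] -/
theorem not_mem_of_dvd_row {𝒜 : Set ℕ} (h𝒜 : ∀ n ∈ 𝒜, n.Prime) {ℓ q i j : ℕ} (hℓ : ℓ.Prime)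
    (hi : ℓ ∣ i) (hq : 1 ≤ q) (hi1 : 1 ≤ i) (hj : 1 ≤ j) : i * q + j * ℓ ∉ 𝒜 := by
  intro hmem
  have hp := h𝒜 _ hmem
  have hdvd : ℓ ∣ i * q + j * ℓ := (hi.mul_right q).add (dvd_mul_left ℓ j)
  have heq := (Nat.prime_dvd_prime_iff_eq hℓ hp).mp hdvd
  have h1 : 1 ≤ i * q := Nat.mul_pos hi1 hq
  have h2 : ℓ ≤ j * ℓ := Nat.le_mul_of_pos_left ℓ hj
  omega

/-- In the column of index `j` with `(j, q) > 1`, every entry `i q + j ℓ` (`i, j, ℓ ≥ 1`) has a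
prime factor `p ≤ q < i q + j ℓ`, hence is not in a set of primes.
[cite: GranvilleSoundararajan2007Uncertainty, §2 proof of Proposition 2.2] -/
theorem not_mem_of_not_coprime_col {𝒜 : Set ℕ} (h𝒜 : ∀ n ∈ 𝒜, n.Prime) {ℓ q i j : ℕ}
    (hjq : ¬ Nat.Coprime j q) (hq : 1 ≤ q) (hi1 : 1 ≤ i) (hℓ1 : 1 ≤ ℓ) (hj : 1 ≤ j) :
    i * q + j * ℓ ∉ 𝒜 := by
  intro hmem
  have hp := h𝒜 _ hmem
  obtain ⟨p, hpp, hpdvd⟩ := Nat.exists_prime_and_dvd (n := Nat.gcd j q) hjq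
  have hpj : p ∣ j := hpdvd.trans (Nat.gcd_dvd_left j q)
  have hpq : p ∣ q := hpdvd.trans (Nat.gcd_dvd_right j q)
  have hdvd : p ∣ i * q + j * ℓ := (hpq.mul_left i).add (hpj.mul_right ℓ)
  have heq := (Nat.prime_dvd_prime_iff_eq hpp hp).mp hdvd
  have hple : p ≤ q := Nat.le_of_dvd hq hpq
  have h1 : q ≤ i * q := Nat.le_mul_of_pos_left q hi1
  have h2 : 1 ≤ j * ℓ := Nat.mul_pos hj hℓ1
  omega

/-! ### The two real inequalities closing the comparison -/

/-- Upper comparison: with `α, β ∈ [0.2475, 1/4]`, `0 < c ≤ 1/100`, `c (L - 1) ≥ 1`,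
`β (α + 2c) L ≤ (1 + 30c) α (β - 2c) (L - 1)`. [folklore] -/
theorem maierMatrix_algebra_upper {α β c L : ℝ} (hα1 : 0.2475 ≤ α) (hα2 : α ≤ 1 / 4)
    (hβ1 : 0.249 ≤ β) (hβ2 : β ≤ 1 / 4) (hc0 : 0 < c) (hc1 : c ≤ 1 / 100)
    (hL : 1 ≤ c * (L - 1)) :
    β * (α + 2 * c) * L ≤ (1 + 30 * c) * α * (β - 2 * c) * (L - 1) := by
  have hkey : 0.7 ≤ 30 * α * β - 2 * α - 60 * c * α - 2 * β := by nlinarith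
  have h1 : β * (α + 2 * c) ≤ 0.07 := by nlinarith
  have hprod : 1 * 0.7 ≤ (c * (L - 1)) * (30 * α * β - 2 * α - 60 * c * α - 2 * β) :=
    mul_le_mul hL hkey (by norm_num) (by linarith)
  linarith

/-- Lower comparison: with `α ∈ [0.2475, 1/4]`, `β ≥ 0.249`, `0 < c ≤ 1/100`, `c (L - 1) ≥ 1` and
`ρ ≤ c/12`, `(1 - 30c) α (L - 1) (β + 2c) ≤ (β (L - 1) - ρ L) (α - 2c)`. [folklore] -/
theorem maierMatrix_algebra_lower {α β c L ρ : ℝ} (hα1 : 0.2475 ≤ α) (hα2 : α ≤ 1 / 4)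
    (hβ1 : 0.249 ≤ β) (hc0 : 0 < c) (hc1 : c ≤ 1 / 100) (hL : 1 ≤ c * (L - 1))
    (hρ : ρ ≤ c / 12) :
    (1 - 30 * c) * α * (L - 1) * (β + 2 * c) ≤ (β * (L - 1) - ρ * L) * (α - 2 * c) := by
  have hb : 0.85 ≤ 30 * α * β - 2 * β - 2 * α + 60 * c * α := by nlinarith
  have hcb : c * 0.85 ≤ c * (30 * α * β - 2 * β - 2 * α + 60 * c * α) :=
    mul_le_mul_of_nonneg_left hb hc0.le
  have hρ' : ρ * (α - 2 * c) ≤ (c / 12) * (1 / 4) :=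
    mul_le_mul hρ (by linarith) (by linarith) (by positivity)
  have hkey : 0.8 * c ≤ c * (30 * α * β - 2 * β - 2 * α + 60 * c * α) - ρ * (α - 2 * c) := by
    linarith
  have hprod : 1 * (0.8 * c) ≤ (c * (L - 1)) *
      (c * (30 * α * β - 2 * β - 2 * α + 60 * c * α) - ρ * (α - 2 * c)) :=
    mul_le_mul hL hkey (by positivity) (by linarith)
  have hsmall : ρ * (α - 2 * c) ≤ 0.8 := by linarith
  nlinarith

/-! ### Proposition 2.2 for subsets of the primes -/

/-- Regularity on a segment with integer endpoints in `(x/4, x)`: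
`|𝒜(n₂; m, a) - 𝒜(n₁; m, a) - (1/φ(m)) (n₂ - n₁) 𝒜(x)/x| < 2c 𝒜(x)/φ(m)`. [folklore] -/
theorem apRegular_segment {𝒜 : Set ℕ} {x c : ℝ} {m : ℕ} (h : APRegular[𝒜, x, c, m]) {n₁ n₂ a : ℕ}
    (ha : a.Coprime m) (h1 : x / 4 < n₁) (h1' : (n₁ : ℝ) < x) (h2 : x / 4 < n₂)
    (h2' : (n₂ : ℝ) < x) :
    |((subsetCountMod 𝒜 m a n₂ : ℝ) - subsetCountMod 𝒜 m a n₁) -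
        1 / (Nat.totient m : ℝ) * (((n₂ : ℝ) - n₁) * (subsetCount 𝒜 x : ℝ) / x)| <
      2 * (c * ((subsetCount 𝒜 x : ℝ) / (Nat.totient m : ℝ))) := by
  have e2 := h n₂ h2 h2' a ha
  have e1 := h n₁ h1 h1' a ha
  rw [abs_lt] at e1 e2 ⊢
  have hid : 1 / (Nat.totient m : ℝ) * (((n₂ : ℝ) - n₁) * (subsetCount 𝒜 x : ℝ) / x) =
      1 / (Nat.totient m : ℝ) * ((n₂ : ℝ) * (subsetCount 𝒜 x : ℝ) / x) -
        1 / (Nat.totient m : ℝ) * ((n₁ : ℝ) * (subsetCount 𝒜 x : ℝ) / x) := by ring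
  rw [hid]
  constructor <;> linarith [e1.1, e1.2, e2.1, e2.2]

/-- **Rows of the Maier matrix.** Counting the elements of a set of primes `𝒜` among the entries
`i q + j ℓ` (`I₀ < i ≤ I₀ + H`, `0 < j ≤ J`) row by row: the row of index `i` is a segment of `J`
consecutive terms of the class `i q (mod ℓ)`, empty of primes when `ℓ ∣ i`, and otherwise counted by
regularity to the modulus `ℓ`. With `U_ℓ, L_ℓ = (1/φ(ℓ)) Jℓ 𝒜(x)/x ± 2c 𝒜(x)/φ(ℓ)`:
`#{i : ℓ ∤ i} · L_ℓ ≤ T ≤ H · U_ℓ`. [cite: GranvilleSoundararajan2007Uncertainty, §2 proof of Proposition 2.2, (2.5a)] -/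
theorem maierMatrix_rows {𝒜 : Set ℕ} [DecidablePred (· ∈ 𝒜)] (h𝒜 : ∀ n ∈ 𝒜, n.Prime) {x c : ℝ}
    {ℓ q : ℕ} (hℓ : ℓ.Prime) (hq : 1 ≤ q) (hcop : Nat.Coprime ℓ q) (hc0 : 0 ≤ c)
    (hregℓ : APRegular[𝒜, x, c, ℓ]) {I₀ H J : ℕ} (hI₀q : x / 4 ≤ (I₀ : ℝ) * q)
    (htop : ((I₀ : ℝ) + H) * q + J * ℓ < x) :
    (#{ij ∈ Ioc I₀ (I₀ + H) ×ˢ Ioc 0 J | ij.1 * q + ij.2 * ℓ ∈ 𝒜} : ℝ) ≤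
        H * (1 / (Nat.totient ℓ : ℝ) * ((J : ℝ) * ℓ * (subsetCount 𝒜 x : ℝ) / x) +
          2 * (c * ((subsetCount 𝒜 x : ℝ) / (Nat.totient ℓ : ℝ)))) ∧
      (#{i ∈ Ioc I₀ (I₀ + H) | ¬ ℓ ∣ i} : ℝ) *
          (1 / (Nat.totient ℓ : ℝ) * ((J : ℝ) * ℓ * (subsetCount 𝒜 x : ℝ) / x) -
            2 * (c * ((subsetCount 𝒜 x : ℝ) / (Nat.totient ℓ : ℝ)))) ≤
        (#{ij ∈ Ioc I₀ (I₀ + H) ×ˢ Ioc 0 J | ij.1 * q + ij.2 * ℓ ∈ 𝒜} : ℝ) := by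
  set A : ℝ := (subsetCount 𝒜 x : ℝ) with hA_def
  set φℓ : ℝ := (Nat.totient ℓ : ℝ) with hφℓ_def
  set rows : Finset ℕ := Ioc I₀ (I₀ + H) with hrows_def
  set cols : Finset ℕ := Ioc 0 J with hcols_def
  set Uℓ : ℝ := 1 / φℓ * ((J : ℝ) * ℓ * A / x) + 2 * (c * (A / φℓ)) with hUℓ_def
  set Lℓ : ℝ := 1 / φℓ * ((J : ℝ) * ℓ * A / x) - 2 * (c * (A / φℓ)) with hLℓ_def
  have hqpos : (0 : ℝ) < q := by exact_mod_cast hq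
  have hℓpos : (0 : ℝ) < ℓ := by exact_mod_cast hℓ.pos
  have hA0 : 0 ≤ A := Nat.cast_nonneg _
  have hx : 0 < x := lt_of_le_of_lt (by positivity) htop
  have hUℓ0 : 0 ≤ Uℓ := by positivity
  have hcard_rows : #rows = H := by rw [hrows_def, Nat.card_Ioc]; omega
  -- the count by rows
  set r : ℕ → ℕ := fun i => #{j ∈ cols | i * q + j * ℓ ∈ 𝒜} with hr_def
  have hT_rows : #{ij ∈ rows ×ˢ cols | ij.1 * q + ij.2 * ℓ ∈ 𝒜} = ∑ i ∈ rows, r i := by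
    rw [card_filter, sum_product]
    refine sum_congr rfl fun i _ => ?_
    simp only [hr_def, card_filter]
  have hrow_mem : ∀ i ∈ rows, I₀ + 1 ≤ i ∧ i ≤ I₀ + H := fun i hi => by
    rw [hrows_def, mem_Ioc] at hi; omega
  have hrow_y : ∀ i ∈ rows, x / 4 < ((i * q : ℕ) : ℝ) ∧ ((i * q : ℕ) : ℝ) < x ∧
      x / 4 < ((i * q + J * ℓ : ℕ) : ℝ) ∧ ((i * q + J * ℓ : ℕ) : ℝ) < x := by
    intro i hi
    obtain ⟨hi1, hi2⟩ := hrow_mem i hi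
    have hi1' : (I₀ : ℝ) + 1 ≤ i := by exact_mod_cast hi1
    have hi2' : (i : ℝ) ≤ I₀ + H := by exact_mod_cast hi2
    have hlo' : ((I₀ : ℝ) + 1) * q ≤ (i : ℝ) * q := mul_le_mul_of_nonneg_right hi1' hqpos.le
    have hhi' : (i : ℝ) * q ≤ ((I₀ : ℝ) + H) * q := mul_le_mul_of_nonneg_right hi2' hqpos.le
    have hJℓ0 : (0 : ℝ) ≤ (J : ℝ) * ℓ := by positivity
    push_cast
    refine ⟨by linarith, by linarith, by linarith, by linarith⟩
  have hrow_eq : ∀ i ∈ rows, (r i : ℝ) =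
      (subsetCountMod 𝒜 ℓ (i * q) ((i * q + J * ℓ : ℕ) : ℝ) : ℝ) -
        subsetCountMod 𝒜 ℓ (i * q) ((i * q : ℕ) : ℝ) := by
    intro i _
    rw [subsetCountMod_sub_eq_card 𝒜 ℓ (i * q) (Nat.le_add_right _ _)]
    simp only [hr_def]
    rw [hcols_def, card_filter_ap_eq 𝒜 (i * q) ℓ 0 J hℓ.pos, zero_mul, add_zero]
  have hrow_bd : ∀ i ∈ rows, ¬ ℓ ∣ i → Lℓ < r i ∧ (r i : ℝ) < Uℓ := by
    intro i hi hndvd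
    have hcopi : (i * q).Coprime ℓ :=
      Nat.Coprime.mul_left (Nat.coprime_comm.mp ((hℓ.coprime_iff_not_dvd).mpr hndvd)) hcop.symm
    obtain ⟨y1, y1', y2, y2'⟩ := hrow_y i hi
    have hseg := apRegular_segment hregℓ hcopi y1 y1' y2 y2'
    rw [← hrow_eq i hi, ← hA_def, ← hφℓ_def] at hseg
    have hdiff : (((i * q + J * ℓ : ℕ) : ℝ) - ((i * q : ℕ) : ℝ)) = (J : ℝ) * ℓ := by
      push_cast; ring
    rw [hdiff, abs_lt] at hseg
    rw [hLℓ_def, hUℓ_def]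
    constructor <;> linarith only [hseg.1, hseg.2]
  have hrow_zero : ∀ i ∈ rows, ℓ ∣ i → r i = 0 := by
    intro i hi hdvd
    obtain ⟨hi1, -⟩ := hrow_mem i hi
    simp only [hr_def, card_eq_zero, filter_eq_empty_iff]
    intro j hj
    rw [hcols_def, mem_Ioc] at hj
    exact not_mem_of_dvd_row h𝒜 hℓ hdvd hq (by omega) (by omega)
  rw [hT_rows, Nat.cast_sum]
  constructor
  · calc ∑ i ∈ rows, (r i : ℝ) ≤ ∑ _i ∈ rows, Uℓ := by
          refine sum_le_sum fun i hi => ?_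
          by_cases hdvd : ℓ ∣ i
          · rw [hrow_zero i hi hdvd, Nat.cast_zero]; exact hUℓ0
          · exact (hrow_bd i hi hdvd).2.le
      _ = H * Uℓ := by rw [sum_const, hcard_rows, nsmul_eq_mul]
  · rw [← sum_filter_add_sum_filter_not rows (fun i => ¬ ℓ ∣ i)]
    have hzero : ∑ i ∈ rows with ¬¬ℓ ∣ i, (r i : ℝ) = 0 := by
      refine sum_eq_zero fun i hi => ?_
      rw [mem_filter, not_not] at hi
      rw [hrow_zero i hi.1 hi.2, Nat.cast_zero]
    rw [hzero, add_zero]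
    calc (#{i ∈ rows | ¬ ℓ ∣ i} : ℝ) * Lℓ = ∑ i ∈ rows with ¬ ℓ ∣ i, Lℓ := by
          rw [sum_const, nsmul_eq_mul]
      _ ≤ ∑ i ∈ rows with ¬ ℓ ∣ i, (r i : ℝ) := by
          refine sum_le_sum fun i hi => ?_
          rw [mem_filter] at hi
          exact (hrow_bd i hi.1 hi.2).1.le

/-- **Columns of the Maier matrix.** The column of index `j` is a segment of `H` consecutive terms
of the class `j ℓ (mod q)`, empty of primes unless `(j, q) = 1`, and then counted by regularity to
the modulus `q`. With `U_q, L_q = (1/φ(q)) Hq 𝒜(x)/x ± 2c 𝒜(x)/φ(q)` and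
`Φ = #{0 < j ≤ J : (j, q) = 1}`: `Φ L_q ≤ T ≤ Φ U_q`.
[cite: GranvilleSoundararajan2007Uncertainty, §2 proof of Proposition 2.2, (2.5b)] -/
theorem maierMatrix_cols {𝒜 : Set ℕ} [DecidablePred (· ∈ 𝒜)] (h𝒜 : ∀ n ∈ 𝒜, n.Prime) {x c : ℝ}
    {ℓ q : ℕ} (hℓ : ℓ.Prime) (hq : 1 ≤ q) (hcop : Nat.Coprime ℓ q)
    (hregq : APRegular[𝒜, x, c, q]) {I₀ H J : ℕ} (hI₀q : x / 4 ≤ (I₀ : ℝ) * q)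
    (htop : ((I₀ : ℝ) + H) * q + J * ℓ < x) :
    (#{ij ∈ Ioc I₀ (I₀ + H) ×ˢ Ioc 0 J | ij.1 * q + ij.2 * ℓ ∈ 𝒜} : ℝ) ≤
        #{j ∈ Ioc 0 J | Nat.Coprime j q} *
          (1 / (Nat.totient q : ℝ) * ((H : ℝ) * q * (subsetCount 𝒜 x : ℝ) / x) +
            2 * (c * ((subsetCount 𝒜 x : ℝ) / (Nat.totient q : ℝ)))) ∧
      (#{j ∈ Ioc 0 J | Nat.Coprime j q} : ℝ) *
          (1 / (Nat.totient q : ℝ) * ((H : ℝ) * q * (subsetCount 𝒜 x : ℝ) / x) -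
            2 * (c * ((subsetCount 𝒜 x : ℝ) / (Nat.totient q : ℝ)))) ≤
        (#{ij ∈ Ioc I₀ (I₀ + H) ×ˢ Ioc 0 J | ij.1 * q + ij.2 * ℓ ∈ 𝒜} : ℝ) := by
  set A : ℝ := (subsetCount 𝒜 x : ℝ) with hA_def
  set φq : ℝ := (Nat.totient q : ℝ) with hφq_def
  set rows : Finset ℕ := Ioc I₀ (I₀ + H) with hrows_def
  set cols : Finset ℕ := Ioc 0 J with hcols_def
  set Uq : ℝ := 1 / φq * ((H : ℝ) * q * A / x) + 2 * (c * (A / φq)) with hUq_def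
  set Lq : ℝ := 1 / φq * ((H : ℝ) * q * A / x) - 2 * (c * (A / φq)) with hLq_def
  have hqpos : (0 : ℝ) < q := by exact_mod_cast hq
  have hℓpos : (0 : ℝ) < ℓ := by exact_mod_cast hℓ.pos
  -- the count by columns
  set col : ℕ → ℕ := fun j => #{i ∈ rows | i * q + j * ℓ ∈ 𝒜} with hcol_def
  have hT_cols : #{ij ∈ rows ×ˢ cols | ij.1 * q + ij.2 * ℓ ∈ 𝒜} = ∑ j ∈ cols, col j := by
    rw [card_filter, sum_product_right]
    refine sum_congr rfl fun j _ => ?_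
    simp only [hcol_def, card_filter]
  have hrow_mem : ∀ i ∈ rows, I₀ + 1 ≤ i ∧ i ≤ I₀ + H := fun i hi => by
    rw [hrows_def, mem_Ioc] at hi; omega
  have hcol_mem : ∀ j ∈ cols, 1 ≤ j ∧ j ≤ J := fun j hj => by
    rw [hcols_def, mem_Ioc] at hj; omega
  have hcol_y : ∀ j ∈ cols, x / 4 < ((j * ℓ + I₀ * q : ℕ) : ℝ) ∧ ((j * ℓ + I₀ * q : ℕ) : ℝ) < x ∧
      x / 4 < ((j * ℓ + (I₀ + H) * q : ℕ) : ℝ) ∧ ((j * ℓ + (I₀ + H) * q : ℕ) : ℝ) < x := by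
    intro j hj
    obtain ⟨hj1, hj2⟩ := hcol_mem j hj
    have hj1' : (1 : ℝ) ≤ j := by exact_mod_cast hj1
    have hj2' : (j : ℝ) ≤ J := by exact_mod_cast hj2
    have hlo : (1 : ℝ) * ℓ ≤ (j : ℝ) * ℓ := mul_le_mul_of_nonneg_right hj1' hℓpos.le
    have hhi : (j : ℝ) * ℓ ≤ (J : ℝ) * ℓ := mul_le_mul_of_nonneg_right hj2' hℓpos.le
    have hHq0 : (0 : ℝ) ≤ (H : ℝ) * q := by positivity
    push_cast
    refine ⟨by linarith, by linarith, by linarith, by linarith⟩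
  have hcol_eq : ∀ j ∈ cols, (col j : ℝ) =
      (subsetCountMod 𝒜 q (j * ℓ) ((j * ℓ + (I₀ + H) * q : ℕ) : ℝ) : ℝ) -
        subsetCountMod 𝒜 q (j * ℓ) ((j * ℓ + I₀ * q : ℕ) : ℝ) := by
    intro j _
    rw [subsetCountMod_sub_eq_card 𝒜 q (j * ℓ)
      (Nat.add_le_add_left (Nat.mul_le_mul_right q (Nat.le_add_right I₀ H)) _)]
    simp only [hcol_def]
    have hre : (rows.filter fun i => i * q + j * ℓ ∈ 𝒜) =
        rows.filter fun i => j * ℓ + i * q ∈ 𝒜 := by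
      refine filter_congr fun i _ => ?_
      rw [add_comm]
    rw [hre, hrows_def, card_filter_ap_eq 𝒜 (j * ℓ) q I₀ (I₀ + H) hq]
  have hcol_bd : ∀ j ∈ cols, Nat.Coprime j q → Lq < col j ∧ (col j : ℝ) < Uq := by
    intro j hj hcopj
    have hcopj' : (j * ℓ).Coprime q := Nat.Coprime.mul_left hcopj hcop
    obtain ⟨y1, y1', y2, y2'⟩ := hcol_y j hj
    have hseg := apRegular_segment hregq hcopj' y1 y1' y2 y2'
    rw [← hcol_eq j hj, ← hA_def, ← hφq_def] at hseg
    have hdiff : (((j * ℓ + (I₀ + H) * q : ℕ) : ℝ) - ((j * ℓ + I₀ * q : ℕ) : ℝ)) = (H : ℝ) * q := by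
      push_cast; ring
    rw [hdiff, abs_lt] at hseg
    rw [hLq_def, hUq_def]
    constructor <;> linarith only [hseg.1, hseg.2]
  have hcol_zero : ∀ j ∈ cols, ¬ Nat.Coprime j q → col j = 0 := by
    intro j hj hncop
    obtain ⟨hj1, -⟩ := hcol_mem j hj
    simp only [hcol_def, card_eq_zero, filter_eq_empty_iff]
    intro i hi
    obtain ⟨hi1, -⟩ := hrow_mem i hi
    exact not_mem_of_not_coprime_col h𝒜 hncop hq (by omega) hℓ.one_le hj1
  have hT_cols' : ((#{ij ∈ rows ×ˢ cols | ij.1 * q + ij.2 * ℓ ∈ 𝒜} : ℕ) : ℝ) =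
      ∑ j ∈ cols with Nat.Coprime j q, (col j : ℝ) := by
    rw [hT_cols, Nat.cast_sum, sum_filter_of_ne]
    intro j hj hne
    by_contra hncop
    rw [hcol_zero j hj hncop, Nat.cast_zero] at hne
    exact hne rfl
  rw [hT_cols']
  constructor
  · calc ∑ j ∈ cols with Nat.Coprime j q, (col j : ℝ) ≤ ∑ j ∈ cols with Nat.Coprime j q, Uq :=
          sum_le_sum fun j hj => (hcol_bd j (mem_filter.mp hj).1 (mem_filter.mp hj).2).2.le
      _ = #{j ∈ cols | Nat.Coprime j q} * Uq := by rw [sum_const, nsmul_eq_mul]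
  · calc (#{j ∈ cols | Nat.Coprime j q} : ℝ) * Lq = ∑ j ∈ cols with Nat.Coprime j q, Lq := by
          rw [sum_const, nsmul_eq_mul]
      _ ≤ ∑ j ∈ cols with Nat.Coprime j q, (col j : ℝ) :=
          sum_le_sum fun j hj => (hcol_bd j (mem_filter.mp hj).1 (mem_filter.mp hj).2).1.le

/-- At most `H/ℓ + 1` of the `H` row indices are multiples of `ℓ`. [folklore] -/
theorem card_filter_not_dvd_ge (I₀ H : ℕ) {ℓ : ℕ} (hℓ : 0 < ℓ) :
    (H : ℝ) - (H / ℓ + 1) ≤ #{i ∈ Ioc I₀ (I₀ + H) | ¬ ℓ ∣ i} := by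
  have hℓpos : (0 : ℝ) < ℓ := by exact_mod_cast hℓ
  have hsplit := card_filter_add_card_filter_not (s := Ioc I₀ (I₀ + H)) (fun i => ℓ ∣ i)
  rw [Nat.card_Ioc, Nat.add_sub_cancel_left] at hsplit
  have hmult : (#{i ∈ Ioc I₀ (I₀ + H) | ℓ ∣ i} : ℝ) ≤ H / ℓ + 1 := by
    have hrows' : Ioc I₀ (I₀ + H) = Icc (I₀ + 1) (I₀ + H) := by
      ext i; simp only [mem_Ioc, mem_Icc]; omega
    rw [hrows', Literature.NumberTheory.Sieve.BrunPureSieve.card_Icc_filter_dvd (by omega) (by omega) ℓ,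
      Nat.add_sub_cancel]
    have h1 : (((I₀ + H) / ℓ : ℕ) : ℝ) ≤ ((I₀ : ℝ) + H) / ℓ := by
      have := (Nat.cast_div_le (m := I₀ + H) (n := ℓ) (α := ℝ))
      push_cast at this
      exact this
    have h2 : (I₀ : ℝ) / ℓ < ((I₀ / ℓ : ℕ) : ℝ) + 1 := by
      have h := Nat.lt_div_mul_add (a := I₀) hℓ
      have h' : (I₀ : ℝ) < ((I₀ / ℓ : ℕ) : ℝ) * ℓ + ℓ := by exact_mod_cast h
      rw [div_lt_iff₀ hℓpos]
      linarith
    have hle : I₀ / ℓ ≤ (I₀ + H) / ℓ := Nat.div_le_div_right (Nat.le_add_right _ _)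
    rw [Nat.cast_sub hle]
    have : ((I₀ : ℝ) + H) / ℓ = I₀ / ℓ + H / ℓ := by ring
    linarith
  have hsplit' : ((#{i ∈ Ioc I₀ (I₀ + H) | ℓ ∣ i} : ℕ) : ℝ) + #{i ∈ Ioc I₀ (I₀ + H) | ¬ ℓ ∣ i} = H := by
    exact_mod_cast hsplit
  linarith

/-- The upper half of the comparison, as an inequality between real parameters: from
`Φ (β - 2c) (ℓ - 1) ≤ H (α + 2c) φ_q` with `H q = β x`, `J ℓ = α x` and the ranges of
`maierMatrix_algebra_upper`, `Φ q / φ_q ≤ (1 + 30c) J`. [folklore] -/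
theorem maierMatrix_upper_of_key {Φ H J q ℓ x φq α β c : ℝ} (hx : 0 < x) (hq : 0 < q) (hℓ : 2 ≤ ℓ)
    (hφq : 0 < φq) (hα1 : 0.2475 ≤ α) (hα2 : α ≤ 1 / 4) (hβ1 : 0.249 ≤ β) (hβ2 : β ≤ 1 / 4)
    (hc0 : 0 < c) (hc1 : c ≤ 1 / 100) (hℓc : 1 ≤ c * (ℓ - 1)) (hαx : α * x = J * ℓ)
    (hβx : β * x = H * q) (e1 : Φ * (β - 2 * c) * (ℓ - 1) ≤ H * (α + 2 * c) * φq) :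
    Φ * q / φq ≤ (1 + 30 * c) * J := by
  have hβc : 0 < β - 2 * c := by norm_num at hβ1; linarith
  have hℓ1 : 0 < ℓ - 1 := by linarith
  have hA' := maierMatrix_algebra_upper hα1 hα2 hβ1 hβ2 hc0 hc1 hℓc
  have e2 : Φ * q * ((β - 2 * c) * (ℓ - 1) * ℓ) ≤
      (1 + 30 * c) * J * φq * ((β - 2 * c) * (ℓ - 1) * ℓ) := by
    have e1' := mul_le_mul_of_nonneg_right e1 (by positivity : (0 : ℝ) ≤ q * ℓ)
    have hA'' := mul_le_mul_of_nonneg_right hA' (by positivity : (0 : ℝ) ≤ x * φq)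
    calc Φ * q * ((β - 2 * c) * (ℓ - 1) * ℓ)
        = Φ * (β - 2 * c) * (ℓ - 1) * (q * ℓ) := by ring
      _ ≤ H * (α + 2 * c) * φq * (q * ℓ) := e1'
      _ = β * (α + 2 * c) * ℓ * (x * φq) := by
          calc H * (α + 2 * c) * φq * (q * ℓ) = (H * q) * ((α + 2 * c) * φq * ℓ) := by ring
            _ = (β * x) * ((α + 2 * c) * φq * ℓ) := by rw [hβx]
            _ = _ := by ring
      _ ≤ (1 + 30 * c) * α * (β - 2 * c) * (ℓ - 1) * (x * φq) := hA''
      _ = (1 + 30 * c) * J * φq * ((β - 2 * c) * (ℓ - 1) * ℓ) := by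
          calc (1 + 30 * c) * α * (β - 2 * c) * (ℓ - 1) * (x * φq)
              = (1 + 30 * c) * (α * x) * ((β - 2 * c) * (ℓ - 1) * φq) := by ring
            _ = (1 + 30 * c) * (J * ℓ) * ((β - 2 * c) * (ℓ - 1) * φq) := by rw [hαx]
            _ = _ := by ring
  have e3 : Φ * q ≤ (1 + 30 * c) * J * φq := le_of_mul_le_mul_right e2 (by positivity)
  rw [div_le_iff₀ hφq]
  exact e3

/-- The lower half of the comparison: from `(H - H/ℓ - 1) (α - 2c) φ_q ≤ Φ (β + 2c) (ℓ - 1)` with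
`H q = β x`, `J ℓ = α x`, `q ≤ c x / 12` and the ranges of `maierMatrix_algebra_lower`,
`(1 - 30c) J ≤ Φ q / φ_q`. [folklore] -/
theorem maierMatrix_lower_of_key {Φ H J q ℓ x φq α β c : ℝ} (hx : 0 < x) (hq : 0 < q) (hℓ : 2 ≤ ℓ)
    (hφq : 0 < φq) (hα1 : 0.2475 ≤ α) (hα2 : α ≤ 1 / 4) (hβ1 : 0.249 ≤ β)
    (hc0 : 0 < c) (hc1 : c ≤ 1 / 100) (hℓc : 1 ≤ c * (ℓ - 1)) (hqx : q / x ≤ c / 12)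
    (hαx : α * x = J * ℓ) (hβx : β * x = H * q)
    (e1 : (H - (H / ℓ + 1)) * (α - 2 * c) * φq ≤ Φ * (β + 2 * c) * (ℓ - 1)) :
    (1 - 30 * c) * J ≤ Φ * q / φq := by
  have hβc' : 0 < β + 2 * c := by norm_num at hβ1; linarith
  have hℓ1 : 0 < ℓ - 1 := by linarith
  have hℓ0 : 0 < ℓ := by linarith
  have hB' := maierMatrix_algebra_lower (L := ℓ) (ρ := q / x) hα1 hα2 hβ1 hc0 hc1 hℓc hqx
  have hid : (β * (ℓ - 1) - q / x * ℓ) * (α - 2 * c) * (x * φq) =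
      (H - (H / ℓ + 1)) * (α - 2 * c) * φq * (q * ℓ) := by
    have h1 : (β * (ℓ - 1) - q / x * ℓ) * x = H * q * (ℓ - 1) - q * ℓ := by
      have : q / x * ℓ * x = q * ℓ := by field_simp
      calc (β * (ℓ - 1) - q / x * ℓ) * x = (β * x) * (ℓ - 1) - q / x * ℓ * x := by ring
        _ = H * q * (ℓ - 1) - q * ℓ := by rw [hβx, this]
    have h2 : (H - (H / ℓ + 1)) * (q * ℓ) = H * q * (ℓ - 1) - q * ℓ := by
      field_simp
      ring
    calc (β * (ℓ - 1) - q / x * ℓ) * (α - 2 * c) * (x * φq)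
        = ((β * (ℓ - 1) - q / x * ℓ) * x) * ((α - 2 * c) * φq) := by ring
      _ = (H * q * (ℓ - 1) - q * ℓ) * ((α - 2 * c) * φq) := by rw [h1]
      _ = ((H - (H / ℓ + 1)) * (q * ℓ)) * ((α - 2 * c) * φq) := by rw [h2]
      _ = _ := by ring
  have e2 : (1 - 30 * c) * J * φq * ((β + 2 * c) * (ℓ - 1) * ℓ) ≤
      Φ * q * ((β + 2 * c) * (ℓ - 1) * ℓ) := by
    have e1' := mul_le_mul_of_nonneg_right e1 (by positivity : (0 : ℝ) ≤ q * ℓ)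
    have hB'' := mul_le_mul_of_nonneg_right hB' (by positivity : (0 : ℝ) ≤ x * φq)
    calc (1 - 30 * c) * J * φq * ((β + 2 * c) * (ℓ - 1) * ℓ)
        = (1 - 30 * c) * α * (ℓ - 1) * (β + 2 * c) * (x * φq) := by
          calc (1 - 30 * c) * J * φq * ((β + 2 * c) * (ℓ - 1) * ℓ)
              = (1 - 30 * c) * (J * ℓ) * ((ℓ - 1) * (β + 2 * c) * φq) := by ring
            _ = (1 - 30 * c) * (α * x) * ((ℓ - 1) * (β + 2 * c) * φq) := by rw [hαx]
            _ = _ := by ring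
      _ ≤ (β * (ℓ - 1) - q / x * ℓ) * (α - 2 * c) * (x * φq) := hB''
      _ = (H - (H / ℓ + 1)) * (α - 2 * c) * φq * (q * ℓ) := hid
      _ ≤ Φ * (β + 2 * c) * (ℓ - 1) * (q * ℓ) := e1'
      _ = Φ * q * ((β + 2 * c) * (ℓ - 1) * ℓ) := by ring
  have e3 : (1 - 30 * c) * J * φq ≤ Φ * q := le_of_mul_le_mul_right e2 (by positivity)
  rw [le_div_iff₀ hφq]
  exact e3
set_option maxHeartbeats 400000 in -- buildfix (bf3-g27): 160k/180k FAIL, 200k PASS at accept time; line-neutral budget line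
/-- **The Maier matrix comparison** (Granville–Soundararajan, Proposition 2.2, for a subset `𝒜` of
the primes, `ℓ` prime, `(ℓ, q) = 1`): if `𝒜` is `c`-regular at scale `x` to both moduli `ℓ` and
`q` (`APRegular[…]`), where `0 < c ≤ 1/100`, `c (ℓ - 1) ≥ 1`, `4ℓ ≤ c x` and `12 q ≤ c x`, then
for `J = ⌊x/4ℓ⌋` the number `Φ_q(J)` of `j ≤ J` coprime to `q` satisfies
`|Φ_q(J) q/φ(q) - J| ≤ 30 c J`. Proof: count the elements of `𝒜` among the entries `i q + j ℓ`
(`⌈x/4q⌉ < i ≤ ⌈x/4q⌉ + ⌊x/4q⌋`, `1 ≤ j ≤ J`) by rows (classes `i q (mod ℓ)`, empty when `ℓ ∣ i`)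
and by columns (classes `j ℓ (mod q)`, empty unless `(j, q) = 1`), and compare.
[cite: GranvilleSoundararajan2007Uncertainty, §2 Proposition 2.2 (proof, (2.5a)–(2.6))] -/
theorem maierMatrix_bounds {𝒜 : Set ℕ} (h𝒜 : ∀ n ∈ 𝒜, n.Prime) {x c : ℝ} {ℓ q : ℕ}
    (hℓ : ℓ.Prime) (hq : 1 ≤ q) (hcop : Nat.Coprime ℓ q) (hc0 : 0 < c) (hc1 : c ≤ 1 / 100)
    (hℓc : 1 ≤ c * ((ℓ : ℝ) - 1)) (hℓx : 4 * (ℓ : ℝ) ≤ c * x) (hqx : 12 * (q : ℝ) ≤ c * x)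
    (hregℓ : APRegular[𝒜, x, c, ℓ]) (hregq : APRegular[𝒜, x, c, q]) :
    |(#{j ∈ Icc 1 ⌊x / (4 * ℓ)⌋₊ | Nat.Coprime j q} : ℝ) * q / (Nat.totient q : ℝ) -
        ⌊x / (4 * ℓ)⌋₊| ≤ 30 * c * ⌊x / (4 * ℓ)⌋₊ := by
  classical
  /- basic sizes -/
  have hℓ2 : (2 : ℝ) ≤ ℓ := by exact_mod_cast hℓ.two_le
  have hℓpos : (0 : ℝ) < ℓ := by linarith
  have hq1 : (1 : ℝ) ≤ q := by exact_mod_cast hq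
  have hqpos : (0 : ℝ) < q := by linarith
  have hx : 0 < x := by nlinarith
  have hℓx' : (ℓ : ℝ) / x ≤ c / 4 := by
    rw [div_le_iff₀ hx]; linarith
  have hqx' : (q : ℝ) / x ≤ c / 12 := by
    rw [div_le_iff₀ hx]; linarith
  have hq4 : (q : ℝ) < x / 4 := by nlinarith
  have hℓ4 : (ℓ : ℝ) < x / 4 := by nlinarith
  set A : ℝ := (subsetCount 𝒜 x : ℝ) with hA_def
  have hA0 : 0 ≤ A := Nat.cast_nonneg _
  set φq : ℝ := (Nat.totient q : ℝ) with hφq_def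
  have hφℓ : (Nat.totient ℓ : ℝ) = (ℓ : ℝ) - 1 := by
    rw [Nat.totient_prime hℓ, Nat.cast_sub hℓ.one_le, Nat.cast_one]
  have hℓ1 : (0 : ℝ) < (ℓ : ℝ) - 1 := by linarith
  have hφqpos : 0 < φq := by
    rw [hφq_def]; exact_mod_cast Nat.totient_pos.mpr hq
  /- `A > 0`: otherwise regularity is contradictory at `y = x/2`, `a = 1` -/
  have hApos : 0 < A := by
    rcases hA0.lt_or_eq with h | h
    · exact h
    · exfalso
      have h2 := hregℓ (x / 2) (by linarith) (by linarith) 1 (Nat.coprime_one_left ℓ)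
      rw [← h] at h2
      simp only [mul_zero, zero_div, mul_zero, sub_zero] at h2
      exact absurd h2 (not_lt.mpr (abs_nonneg _))
  /- the matrix parameters -/
  set I₀ : ℕ := ⌈x / (4 * q)⌉₊ with hI₀_def
  set H : ℕ := ⌊x / (4 * q)⌋₊ with hH_def
  set J : ℕ := ⌊x / (4 * ℓ)⌋₊ with hJ_def
  have hcols : Icc 1 J = Ioc 0 J := by
    ext j; simp only [mem_Icc, mem_Ioc]; omega
  rw [hcols]
  have hI₀ : x / (4 * q) ≤ I₀ := Nat.le_ceil _
  have hI₀' : (I₀ : ℝ) < x / (4 * q) + 1 := Nat.ceil_lt_add_one (by positivity)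
  have hH : (H : ℝ) ≤ x / (4 * q) := Nat.floor_le (by positivity)
  have hH' : x / (4 * q) < H + 1 := Nat.lt_floor_add_one _
  have hJ : (J : ℝ) ≤ x / (4 * ℓ) := Nat.floor_le (by positivity)
  have hJ' : x / (4 * ℓ) < J + 1 := Nat.lt_floor_add_one _
  have hx4q : x / (4 * q) * q = x / 4 := by field_simp
  have hx4ℓ : x / (4 * ℓ) * ℓ = x / 4 := by field_simp
  have hI₀q : x / 4 ≤ (I₀ : ℝ) * q := by
    rw [← hx4q]; exact mul_le_mul_of_nonneg_right hI₀ hqpos.le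
  have hI₀q' : (I₀ : ℝ) * q < x / 4 + q := by
    have := mul_lt_mul_of_pos_right hI₀' hqpos
    rwa [add_mul, hx4q, one_mul] at this
  have hHq : (H : ℝ) * q ≤ x / 4 := by
    rw [← hx4q]; exact mul_le_mul_of_nonneg_right hH hqpos.le
  have hHq' : x / 4 - q < (H : ℝ) * q := by
    have := mul_lt_mul_of_pos_right hH' hqpos
    rw [add_mul, hx4q, one_mul] at this
    linarith
  have hJℓ : (J : ℝ) * ℓ ≤ x / 4 := by
    rw [← hx4ℓ]; exact mul_le_mul_of_nonneg_right hJ hℓpos.le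
  have hJℓ' : x / 4 - ℓ < (J : ℝ) * ℓ := by
    have := mul_lt_mul_of_pos_right hJ' hℓpos
    rw [add_mul, hx4ℓ, one_mul] at this
    linarith
  have htop : ((I₀ : ℝ) + H) * q + J * ℓ < x := by nlinarith
  /- rows and columns -/
  obtain ⟨hR1, hR2⟩ := maierMatrix_rows h𝒜 hℓ hq hcop hc0.le hregℓ hI₀q htop
  obtain ⟨hC1, hC2⟩ := maierMatrix_cols h𝒜 hℓ hq hcop hregq hI₀q htop
  rw [← hA_def, hφℓ] at hR1 hR2
  rw [← hA_def, ← hφq_def] at hC1 hC2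
  have hH'_ge := card_filter_not_dvd_ge I₀ H hℓ.pos
  set Φ : ℕ := #{j ∈ Ioc 0 J | Nat.Coprime j q} with hΦ_def
  set H' : ℕ := #{i ∈ Ioc I₀ (I₀ + H) | ¬ ℓ ∣ i} with hH'_def
  set T : ℕ := #{ij ∈ Ioc I₀ (I₀ + H) ×ˢ Ioc 0 J | ij.1 * q + ij.2 * ℓ ∈ 𝒜} with hT_def
  /- normalised parameters -/
  set α : ℝ := (J : ℝ) * ℓ / x with hα_def
  set β : ℝ := (H : ℝ) * q / x with hβ_def
  have hαx : α * x = (J : ℝ) * ℓ := by rw [hα_def]; field_simp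
  have hβx : β * x = (H : ℝ) * q := by rw [hβ_def]; field_simp
  have hα2 : α ≤ 1 / 4 := by
    rw [hα_def, div_le_iff₀ hx]; linarith
  have hα1 : 0.2475 ≤ α := by
    have h1 : 1 / 4 - (ℓ : ℝ) / x < α := by
      rw [hα_def, lt_div_iff₀ hx, sub_mul, div_mul_cancel₀ _ hx.ne']; linarith
    have h2 : (ℓ : ℝ) / x ≤ 1 / 400 := by linarith
    norm_num at h1 ⊢; linarith
  have hβ2 : β ≤ 1 / 4 := by
    rw [hβ_def, div_le_iff₀ hx]; linarith
  have hβ1 : 0.249 ≤ β := by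
    have h1 : 1 / 4 - (q : ℝ) / x < β := by
      rw [hβ_def, lt_div_iff₀ hx, sub_mul, div_mul_cancel₀ _ hx.ne']; linarith
    have h2 : (q : ℝ) / x ≤ 1 / 1200 := by linarith
    norm_num at h1 ⊢; linarith
  have hαc : 0 ≤ α - 2 * c := by norm_num at hα1; linarith
  -- rewrite the four bounds with `α`, `β`
  have hUℓ : 1 / ((ℓ : ℝ) - 1) * ((J : ℝ) * ℓ * A / x) + 2 * (c * (A / ((ℓ : ℝ) - 1))) =
      A / ((ℓ : ℝ) - 1) * (α + 2 * c) := by rw [hα_def]; ring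
  have hLℓ : 1 / ((ℓ : ℝ) - 1) * ((J : ℝ) * ℓ * A / x) - 2 * (c * (A / ((ℓ : ℝ) - 1))) =
      A / ((ℓ : ℝ) - 1) * (α - 2 * c) := by rw [hα_def]; ring
  have hUq : 1 / φq * ((H : ℝ) * q * A / x) + 2 * (c * (A / φq)) = A / φq * (β + 2 * c) := by
    rw [hβ_def]; ring
  have hLq : 1 / φq * ((H : ℝ) * q * A / x) - 2 * (c * (A / φq)) = A / φq * (β - 2 * c) := by
    rw [hβ_def]; ring
  rw [hUℓ] at hR1
  rw [hLℓ] at hR2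
  rw [hUq] at hC1
  rw [hLq] at hC2
  /- upper bound -/
  have key1 : (Φ : ℝ) * (A / φq * (β - 2 * c)) ≤ H * (A / ((ℓ : ℝ) - 1) * (α + 2 * c)) :=
    hC2.trans hR1
  have e1 : (Φ : ℝ) * (β - 2 * c) * ((ℓ : ℝ) - 1) ≤ H * (α + 2 * c) * φq := by
    have e := mul_le_mul_of_nonneg_right key1 (by positivity : (0 : ℝ) ≤ ((ℓ : ℝ) - 1) * φq / A)
    have lhs : (Φ : ℝ) * (A / φq * (β - 2 * c)) * (((ℓ : ℝ) - 1) * φq / A) =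
        Φ * (β - 2 * c) * ((ℓ : ℝ) - 1) := by field_simp
    have rhs : (H : ℝ) * (A / ((ℓ : ℝ) - 1) * (α + 2 * c)) * (((ℓ : ℝ) - 1) * φq / A) =
        H * (α + 2 * c) * φq := by field_simp
    rwa [lhs, rhs] at e
  have hup := maierMatrix_upper_of_key hx hqpos hℓ2 hφqpos hα1 hα2 hβ1 hβ2 hc0 hc1 hℓc hαx hβx e1
  /- lower bound -/
  have key2 : (H' : ℝ) * (A / ((ℓ : ℝ) - 1) * (α - 2 * c)) ≤ Φ * (A / φq * (β + 2 * c)) :=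
    hR2.trans hC1
  have e2 : (H' : ℝ) * (α - 2 * c) * φq ≤ Φ * (β + 2 * c) * ((ℓ : ℝ) - 1) := by
    have e := mul_le_mul_of_nonneg_right key2 (by positivity : (0 : ℝ) ≤ ((ℓ : ℝ) - 1) * φq / A)
    have lhs : (H' : ℝ) * (A / ((ℓ : ℝ) - 1) * (α - 2 * c)) * (((ℓ : ℝ) - 1) * φq / A) =
        H' * (α - 2 * c) * φq := by field_simp
    have rhs : (Φ : ℝ) * (A / φq * (β + 2 * c)) * (((ℓ : ℝ) - 1) * φq / A) =
        Φ * (β + 2 * c) * ((ℓ : ℝ) - 1) := by field_simp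
    rwa [lhs, rhs] at e
  have e2' : ((H : ℝ) - (H / ℓ + 1)) * (α - 2 * c) * φq ≤ Φ * (β + 2 * c) * ((ℓ : ℝ) - 1) := by
    refine le_trans ?_ e2
    exact mul_le_mul_of_nonneg_right (mul_le_mul_of_nonneg_right hH'_ge hαc) hφqpos.le
  have hlow := maierMatrix_lower_of_key hx hqpos hℓ2 hφqpos hα1 hα2 hβ1 hc0 hc1 hℓc hqx' hαx hβx e2'
  /- conclusion -/
  rw [abs_sub_le_iff]
  constructor <;> linarith

end Literature.Barriers.Parity

end
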